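import Summits.FinalStateConjecture.FinalStateConjecture.Theorems.PhotonSphereChannelsEndVisibleDefs
import Literature.Geometry.Lorentzian.CauchyDevelopmentAcausal
import Literature.Geometry.Lorentzian.CausalityClosure
import Literature.Geometry.Lorentzian.NormalisedNullRayCausal
import Literature.Geometry.Lorentzian.MinkowskiGlobalHyperbolicity
import HarnessLib

/-!
# Route PhotonSphereChannels · crux `ChannelsResolveTameDevelopmentsR` (K2R-T2, stmt-FinalStateConjecture-17430) —
# line `Sketch`, cycle 3: OUTER-REGION ADHERENCE and the set forms of the two ray clauses

In every Cauchy development `𝒟` (data hypersurface `ι(X)` Cauchy, hence acausal with trivial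
horismos, `CauchyDevelopmentAcausal`), every point `γ t`, `t ≥ 0`, of every future-complete
normalised null ray `γ` from the data ADHERES to the future domain of outer communications
`outerRegion 𝒟 = J⁺(ι X) ∩ I⁻(complete rays)` (hypothesis (ii)'s `outer`, `TrappedSet.outerRegion`):
`γ t ∈ closure (outerRegion 𝒟)` (`mem_closure_outerRegion`), i.e.
`completeNullRayRegion ⊆ closure outerRegion` (`completeNullRayRegion_subset_closure_outerRegion`).
Proof: for `t > 0` the point `γ t` lies in the OPEN set `I⁺(ι X)` (it is in `J⁺(ι X) ⊆ ι(X) ∪ I⁺(ι X)`,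
and `γ t ∈ ι(X)` would make `γ|[0, t]` a causal curve returning to the acausal `ι(X)`), and
`γ t ∈ closure I⁻(γ t)`; so points `r ≪ γ t` with `r ∈ I⁺(ι X)` accumulate at `γ t`, and each such `r`
is in `outerRegion 𝒟`. For `t = 0` (and uniformly) `γ t = lim_{s ↓ t} γ s` along the ray.

Consequences — the two RAY clauses of the crux / of line `Sketch` are SET inclusions about the d.o.c.:

* summit clause (C) for an honest region: `RaysStayInClosure 𝒟 (exteriorOf 𝒟 U) ↔ outerRegion 𝒟 ⊆ exteriorOf 𝒟 U`
  (`raysStayInClosure_exteriorOf_iff_outerRegion_subset`; `⇒` is the landed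
  `outerRegion_subset_exteriorOf_of_raysStayInClosure`), and for any `O`,
  `outerRegion 𝒟 ⊆ closure O → RaysStayInClosure 𝒟 O`;
* NoHidden per development: `CompleteRaysNearEndVisible 𝒟 ↔ outerRegion 𝒟 ⊆ endVisibleRegion 𝒟 ↔
  endVisibleRegion 𝒟 ∩ J⁺(ι X) = outerRegion 𝒟` (`completeRaysNearEndVisible_iff_outerRegion_subset`,
  `completeRaysNearEndVisible_iff_eq`): "the domain of outer communications computed from ALL
  future-complete rays from `Σ` is already the past of the far-launched ones".

So the operator's pending ruling on summit clause (C) (multi-topology `Σ`, hidden expanding bag) and the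
planner's re-keying (α)/(α′) of item 17430 (`Cruxes/…/ReKey17430.lean`) each concern ONE closure-free
set inclusion. Registered sub-goal of line `Sketch`: `stub_outerRegionAdherence` (§2).

§4 (appended, same cycle): hiddenness is a TAIL property — by push-up, along a complete ray membership
in the closure of a past set is an initial-segment property of the parameter, so NoHidden (resp. (C)
for an honest region) holds iff every complete ray RETURNS to `closure (endVisibleRegion 𝒟)` (resp.
`closure (exteriorOf 𝒟 U)`) at arbitrarily late parameters (`completeRaysNearEndVisible_iff_frequently`,
registered sub-goal `stub_hiddenTail`; `raysStayInClosure_exteriorOf_iff_frequently`).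

References: O'Neill 1983, Ch. 14, Lemma 14.3 (p. 403: `I⁺(A)` open), Lemma 14.6 (2) (`A ⊆ cl I⁺(A)`),
Lemma 14.42 (p. 425: a spacelike Cauchy hypersurface is acausal); Hawking–Ellis 1973, §6.5, §9.2;
Wald 1984, §12.1.
-/

noncomputable section

set_option linter.dupNamespace false

open Set Filter Topology TopologicalSpace
open scoped Manifold ContDiff ENNReal
open Literature.Geometry.Lorentzian

namespace Summit.FinalStateConjecture.FinalStateConjecture.Theorems.EndVisible

variable {X : Type} [TopologicalSpace X] [ChartedSpace E3 X] [IsManifold (𝓡 3) ∞ X]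
  [ConnectedSpace X] {D : InitialDataSet (𝓡 3) X} {𝒟 : CauchyDevelopment D}

/-! ## §1. Rays: the nonnegative half-line lies in the domain; positive parameters lie in `I⁺(ι X)` -/

/-- The affine domain of a future-complete normalised null ray (an open interval containing `0`,
unbounded above) contains the half-line `[0, ∞)`. [cite: ONeillSemiRiemannian1983, Ch. 3, p. 68] -/
theorem Ici_subset_of_not_bddAbove [𝒟.metric.HasLeviCivita] {p : X} {γ : ℝ → 𝒟.carrier} {dom : Set ℝ}
    (hγ : 𝒟.metric.IsNormalisedNullRayFrom 𝒟.timeOrientation 𝒟.embed 𝒟.normal p γ dom)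
    (hdom : ¬ BddAbove dom) : Ici (0 : ℝ) ⊆ dom := by
  intro s hs
  by_contra hsd
  refine hdom ⟨s, fun u hu ↦ not_lt.1 fun hsu ↦ hsd ?_⟩
  exact hγ.isMaximalGeodesicOn.2.1.out hγ.zero_mem hu ⟨hs, hsu.le⟩

/-- **A ray point of POSITIVE parameter lies in the chronological future of the data**: `γ t ∈ J⁺(ι X)`
(`IsNormalisedNullRayFrom.mem_causalFuture_range`), `J⁺(ι X) ⊆ ι(X) ∪ I⁺(ι X)` (trivial horismos of the
Cauchy hypersurface, `CauchyDevelopment.causalFuture_range_embed_subset_union`), and `γ t ∈ ι(X)` with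
`t > 0` would make `γ|[0, t]` a future causal curve from `ι(X)` back to `ι(X)`, excluded by acausality
(`CauchyDevelopment.false_of_isFutureCausalCurveOn_range_embed`).
[cite: ONeillSemiRiemannian1983, Ch. 14, Lemma 14.42 (p. 425)] -/
theorem mem_chronologicalFuture_range_of_pos [𝒟.metric.HasLeviCivita] {p : X} {γ : ℝ → 𝒟.carrier}
    {dom : Set ℝ} (hγ : 𝒟.metric.IsNormalisedNullRayFrom 𝒟.timeOrientation 𝒟.embed 𝒟.normal p γ dom)
    {t : ℝ} (ht : t ∈ dom) (h0 : 0 < t) :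
    γ t ∈ 𝒟.metric.chronologicalFuture 𝒟.timeOrientation (range 𝒟.embed) := by
  rcases 𝒟.causalFuture_range_embed_subset_union (hγ.mem_causalFuture_range ht h0.le) with hS | hI
  · exact (𝒟.false_of_isFutureCausalCurveOn_range_embed h0
      (hγ.isFutureCausalCurveOn.mono (hγ.isMaximalGeodesicOn.2.1.out hγ.zero_mem ht))
      (by rw [hγ.apply_zero]; exact mem_range_self p) hS).elim
  · exact hI

/-- A ray is continuous at every parameter of its affine domain (it is a geodesic there).
[cite: ONeillSemiRiemannian1983, Ch. 3, p. 67] -/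
theorem continuousAt_of_isNormalisedNullRayFrom [𝒟.metric.HasLeviCivita] {p : X} {γ : ℝ → 𝒟.carrier}
    {dom : Set ℝ} (hγ : 𝒟.metric.IsNormalisedNullRayFrom 𝒟.timeOrientation 𝒟.embed 𝒟.normal p γ dom)
    {t : ℝ} (ht : t ∈ dom) : ContinuousAt γ t :=
  (IsGeodesicOn.mdifferentiableAt_holds hγ.isMaximalGeodesicOn.isGeodesicOn ht).continuousAt

/-! ## §2. Outer-region adherence -/

/-- Adherence at positive parameters: for `t > 0`, `γ t ∈ closure (outerRegion 𝒟)` — points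
`r ≪ γ t` accumulate at `γ t` (`A ⊆ cl I⁻(A)`, O'Neill Lemma 14.6 (2), time dual), those inside the
open neighbourhood `I⁺(ι X)` of `γ t` (Lemma 14.3) lie in `J⁺(ι X) ∩ I⁻(γ '' (dom ∩ [0, ∞)))`.
[cite: ONeillSemiRiemannian1983, Ch. 14, Lemma 14.6 (2)] -/
theorem mem_closure_outerRegion_of_pos [𝒟.metric.HasLeviCivita] {p : X} {γ : ℝ → 𝒟.carrier}
    {dom : Set ℝ} (hγ : 𝒟.metric.IsNormalisedNullRayFrom 𝒟.timeOrientation 𝒟.embed 𝒟.normal p γ dom)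
    (hdom : ¬ BddAbove dom) {t : ℝ} (ht : t ∈ dom) (h0 : 0 < t) :
    γ t ∈ closure (TrappedSet.outerRegion 𝒟) := by
  have hI := mem_chronologicalFuture_range_of_pos hγ ht h0
  have hIo := LorentzianMetric.isOpen_chronologicalFuture_of_boundaryless 𝒟.metric 𝒟.timeOrientation
    (range 𝒟.embed)
  have hcl : γ t ∈ closure (𝒟.metric.chronologicalPast 𝒟.timeOrientation {γ t}) :=
    𝒟.metric.subset_closure_chronologicalFuture 𝒟.timeOrientation.reverse {γ t} rfl
  rw [mem_closure_iff_nhds]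
  intro W hW
  obtain ⟨r, ⟨hrW, hrI⟩, hr⟩ := mem_closure_iff_nhds.1 hcl _ (inter_mem hW (hIo.mem_nhds hI))
  have hmem : γ t ∈ γ '' (dom ∩ Ici 0) := mem_image_of_mem γ ⟨ht, h0.le⟩
  refine ⟨r, hrW, LorentzianMetric.chronologicalFuture_subset_causalFuture _ _ _ hrI, p, γ, dom, hγ, hdom, ?_⟩
  exact LorentzianMetric.chronologicalPast_mono (singleton_subset_iff.2 hmem) hr

/-- **Outer-region adherence** (registered sub-goal `stub_outerRegionAdherence` of line `Sketch`, crux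
stmt-FinalStateConjecture-17430): in a Cauchy development, every point `γ t`, `t ≥ 0`, of every
future-complete normalised null ray from the data lies in the closure of the future domain of outer
communications `outerRegion 𝒟 = J⁺(ι X) ∩ I⁻(complete rays)`. (For `t ≥ 0`: `γ t = lim_{s ↓ t} γ s`
with `γ s`, `s > t`, adherent by `mem_closure_outerRegion_of_pos`.) In particular the future-complete
horizon generators issuing from `Σ` lie in `closure (outerRegion 𝒟)`.
[cite: ONeillSemiRiemannian1983, Ch. 14, Lemma 14.6 (2)] -/
theorem mem_closure_outerRegion [𝒟.metric.HasLeviCivita] {p : X} {γ : ℝ → 𝒟.carrier}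
    {dom : Set ℝ} (hγ : 𝒟.metric.IsNormalisedNullRayFrom 𝒟.timeOrientation 𝒟.embed 𝒟.normal p γ dom)
    (hdom : ¬ BddAbove dom) {t : ℝ} (ht : t ∈ dom) (h0 : 0 ≤ t) :
    γ t ∈ closure (TrappedSet.outerRegion 𝒟) := by
  have hc : Tendsto γ (𝓝[>] t) (𝓝 (γ t)) :=
    (continuousAt_of_isNormalisedNullRayFrom hγ ht).tendsto.mono_left nhdsWithin_le_nhds
  have hev : ∀ᶠ s in 𝓝[>] t, γ s ∈ closure (TrappedSet.outerRegion 𝒟) :=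
    eventually_nhdsWithin_of_forall fun s hs ↦ mem_closure_outerRegion_of_pos hγ hdom
      (Ici_subset_of_not_bddAbove hγ hdom (h0.trans (le_of_lt hs))) (h0.trans_lt hs)
  have h := mem_closure_of_tendsto hc hev
  rwa [closure_closure] at h

/-- **Registered sub-goal `stub_outerRegionAdherence`** (one-line signature, = `mem_closure_outerRegion`).
[cite: ONeillSemiRiemannian1983, Ch. 14, Lemma 14.6 (2)] -/
theorem stub_outerRegionAdherence : ∀ {X : Type} [TopologicalSpace X] [ChartedSpace E3 X] [IsManifold (𝓡 3) ∞ X] [ConnectedSpace X] {D : InitialDataSet (𝓡 3) X} {𝒟 : CauchyDevelopment D} [𝒟.metric.HasLeviCivita] {p : X} {γ : ℝ → 𝒟.carrier} {dom : Set ℝ}, 𝒟.metric.IsNormalisedNullRayFrom 𝒟.timeOrientation 𝒟.embed 𝒟.normal p γ dom → ¬ BddAbove dom → ∀ t ∈ dom, 0 ≤ t → γ t ∈ closure (TrappedSet.outerRegion 𝒟) :=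
  fun hγ hdom _ ht h0 ↦ mem_closure_outerRegion hγ hdom ht h0

/-- **The complete-ray region adheres to the outer region**: `completeNullRayRegion ⊆ closure outerRegion`
(the intrinsic "`𝓘⁺` and the complete horizon generators lie in the closure of the d.o.c.").
[cite: HawkingEllis1973, §9.2] -/
theorem completeNullRayRegion_subset_closure_outerRegion [𝒟.metric.HasLeviCivita] :
    𝒟.metric.completeNullRayRegion 𝒟.timeOrientation 𝒟.embed 𝒟.normal ⊆
      closure (TrappedSet.outerRegion 𝒟) := by
  intro q hq
  obtain ⟨p, δ, s, t, hδ, hs, ht, h0, rfl⟩ := LorentzianMetric.mem_completeNullRayRegion_iff.1 hq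
  exact mem_closure_outerRegion hδ hs ht h0

/-- The outer region and the complete-ray region have the same closure as the outer region alone:
`closure (outerRegion 𝒟 ∪ completeNullRayRegion) = closure (outerRegion 𝒟)`. [cite: HawkingEllis1973, §9.2] -/
theorem closure_outerRegion_union_completeNullRayRegion [𝒟.metric.HasLeviCivita] :
    closure (TrappedSet.outerRegion 𝒟 ∪ 𝒟.metric.completeNullRayRegion 𝒟.timeOrientation 𝒟.embed 𝒟.normal) =
      closure (TrappedSet.outerRegion 𝒟) := by
  refine Subset.antisymm ?_ (closure_mono subset_union_left)
  rw [closure_union]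
  exact union_subset Subset.rfl
    ((closure_mono completeNullRayRegion_subset_closure_outerRegion).trans (by rw [closure_closure]))

/-! ## §3. The ray clauses as set inclusions -/

/-- **(C) unfolded**: `RaysStayInClosure 𝒟 O ↔ completeNullRayRegion ⊆ closure O` (the clause quantifies
exactly over the points of the complete-ray region). [cite: DafermosLuk2017, Conjecture 1] -/
theorem raysStayInClosure_iff_completeNullRayRegion_subset {O : Set 𝒟.carrier} :
    _root_.Summit.FinalStateConjecture.RaysStayInClosure 𝒟 O ↔
      ∀ [𝒟.metric.HasLeviCivita],
        𝒟.metric.completeNullRayRegion 𝒟.timeOrientation 𝒟.embed 𝒟.normal ⊆ closure O := by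
  constructor
  · intro h _ q hq
    obtain ⟨p, δ, s, t, hδ, hs, ht, h0, rfl⟩ := LorentzianMetric.mem_completeNullRayRegion_iff.1 hq
    exact h p δ s hδ hs t ht h0
  · intro h _ p γ dom hγ hdom t ht h0
    exact h (LorentzianMetric.mem_completeNullRayRegion_iff.2 ⟨p, γ, dom, t, hγ, hdom, ht, h0, rfl⟩)

/-- **NoHidden unfolded**: `CompleteRaysNearEndVisible 𝒟 ↔ completeNullRayRegion ⊆ closure (endVisibleRegion 𝒟)`.
[cite: HawkingEllis1973, §9.2] -/
theorem completeRaysNearEndVisible_iff_completeNullRayRegion_subset :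
    CompleteRaysNearEndVisible 𝒟 ↔
      ∀ [𝒟.metric.HasLeviCivita],
        𝒟.metric.completeNullRayRegion 𝒟.timeOrientation 𝒟.embed 𝒟.normal ⊆ closure (endVisibleRegion 𝒟) := by
  constructor
  · intro h _ q hq
    obtain ⟨p, δ, s, t, hδ, hs, ht, h0, rfl⟩ := LorentzianMetric.mem_completeNullRayRegion_iff.1 hq
    exact h p δ s hδ hs t ht h0
  · intro h _ p γ dom hγ hdom t ht h0
    exact h (LorentzianMetric.mem_completeNullRayRegion_iff.2 ⟨p, γ, dom, t, hγ, hdom, ht, h0, rfl⟩)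

/-- **(C) from a set inclusion**: if the outer region lies in `closure O` then every future-complete
normalised null ray from the data stays in `closure O`. [cite: DafermosLuk2017, Conjecture 1] -/
theorem raysStayInClosure_of_outerRegion_subset_closure {O : Set 𝒟.carrier}
    (h : ∀ [𝒟.metric.HasLeviCivita], TrappedSet.outerRegion 𝒟 ⊆ closure O) :
    _root_.Summit.FinalStateConjecture.RaysStayInClosure 𝒟 O := by
  intro _ p γ dom hγ hdom t ht h0
  have h' := closure_mono h (mem_closure_outerRegion hγ hdom ht h0)
  rwa [closure_closure] at h'

/-- **The closure of the outer region always satisfies (C)**: `RaysStayInClosure 𝒟 (closure (outerRegion 𝒟))`,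
and hence (monotonicity) so does every `O ⊇ outerRegion 𝒟` — the future domain of outer communications is
the least candidate for the settled region up to closure. [cite: DafermosLuk2017, Conjecture 1] -/
theorem raysStayInClosure_closure_outerRegion [𝒟.metric.HasLeviCivita] :
    _root_.Summit.FinalStateConjecture.RaysStayInClosure 𝒟 (closure (TrappedSet.outerRegion 𝒟)) := by
  intro _ p γ dom hγ hdom t ht h0
  rw [closure_closure]
  exact mem_closure_outerRegion hγ hdom ht h0

/-- **Summit clause (C) for an honest region is ONE set inclusion**:
`RaysStayInClosure 𝒟 (exteriorOf 𝒟 U) ↔ outerRegion 𝒟 ⊆ exteriorOf 𝒟 U` — the settled exterior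
`J⁺(ι X) ∩ I⁻(U)` must contain the whole future domain of outer communications `J⁺(ι X) ∩ I⁻(all
future-complete rays from Σ)` (hidden regions included). `⇒` is `outerRegion_subset_exteriorOf_of_raysStayInClosure`
(push-up through the open `I⁺(q)`), `⇐` is adherence. [cite: DafermosLuk2017, Conjecture 1] -/
theorem raysStayInClosure_exteriorOf_iff_outerRegion_subset (U : Set 𝒟.carrier) :
    _root_.Summit.FinalStateConjecture.RaysStayInClosure 𝒟 (_root_.Summit.FinalStateConjecture.exteriorOf 𝒟 U) ↔
      ∀ [𝒟.metric.HasLeviCivita], TrappedSet.outerRegion 𝒟 ⊆ _root_.Summit.FinalStateConjecture.exteriorOf 𝒟 U :=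
  ⟨fun h _ ↦ outerRegion_subset_exteriorOf_of_raysStayInClosure U h,
    fun h ↦ raysStayInClosure_of_outerRegion_subset_closure fun {_} ↦ h.trans subset_closure⟩

/-- **NoHidden per development is ONE set inclusion**:
`CompleteRaysNearEndVisible 𝒟 ↔ outerRegion 𝒟 ⊆ endVisibleRegion 𝒟` — every event of the future domain
of outer communications is already in the past of complete rays launched outside any compact piece of
the data. `⇒` is `outerRegion_subset_endVisibleRegion_of_completeRaysNearEndVisible`, `⇐` is adherence.
[cite: HawkingEllis1973, §9.2] -/
theorem completeRaysNearEndVisible_iff_outerRegion_subset :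
    CompleteRaysNearEndVisible 𝒟 ↔
      ∀ [𝒟.metric.HasLeviCivita], TrappedSet.outerRegion 𝒟 ⊆ endVisibleRegion 𝒟 :=
  ⟨fun h _ ↦ outerRegion_subset_endVisibleRegion_of_completeRaysNearEndVisible h,
    fun h _ _ _ _ hγ hdom _ ht h0 ↦ closure_mono h (mem_closure_outerRegion hγ hdom ht h0)⟩

/-- **NoHidden per development, as an equality of regions**:
`CompleteRaysNearEndVisible 𝒟 ↔ endVisibleRegion 𝒟 ∩ J⁺(ι X) = outerRegion 𝒟` — the domain of outer
communications computed from ALL future-complete rays from `Σ` coincides with the one computed from the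
far-launched rays. [cite: HawkingEllis1973, §9.2] -/
theorem completeRaysNearEndVisible_iff_eq :
    CompleteRaysNearEndVisible 𝒟 ↔
      ∀ [𝒟.metric.HasLeviCivita],
        endVisibleRegion 𝒟 ∩ 𝒟.metric.causalFuture 𝒟.timeOrientation (range 𝒟.embed) =
          TrappedSet.outerRegion 𝒟 :=
  ⟨fun h _ ↦ endVisibleRegion_inter_causalFuture_eq_outerRegion h,
    fun h ↦ completeRaysNearEndVisible_iff_outerRegion_subset.2 fun {_} _ hq ↦ (h.symm.subset hq).1⟩

/-- **NoHidden up to closure suffices**: `outerRegion 𝒟 ⊆ closure (endVisibleRegion 𝒟)` already gives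
`CompleteRaysNearEndVisible 𝒟` (adherence), hence `outerRegion 𝒟 ⊆ endVisibleRegion 𝒟` itself.
[cite: HawkingEllis1973, §9.2] -/
theorem completeRaysNearEndVisible_of_outerRegion_subset_closure
    (h : ∀ [𝒟.metric.HasLeviCivita], TrappedSet.outerRegion 𝒟 ⊆ closure (endVisibleRegion 𝒟)) :
    CompleteRaysNearEndVisible 𝒟 := by
  intro _ p γ dom hγ hdom t ht h0
  have h' := closure_mono h (mem_closure_outerRegion hγ hdom ht h0)
  rwa [closure_closure] at h'

/-- **C_end's adapter obligation at positive parameters**: a ray point `γ t`, `t > 0`, lying in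
`closure S` lies in `closure (S ∩ J⁺(ι X))` — because `I⁺(ι X)` is an open neighbourhood of `γ t`
inside `J⁺(ι X)`. (This discharges, for `t > 0`, the hypothesis `hfut` of
`endVisibleRaysStayInClosure_of_farRaysShadowedBy`; at `t = 0`, `γ 0 = ι p ∈ Σ`, it is a statement
about how `S` accumulates at the data hypersurface and is not automatic.)
[cite: ONeillSemiRiemannian1983, Ch. 14, Lemma 14.3 (p. 403)] -/
theorem mem_closure_inter_causalFuture_of_pos [𝒟.metric.HasLeviCivita] {p : X} {γ : ℝ → 𝒟.carrier}
    {dom : Set ℝ} (hγ : 𝒟.metric.IsNormalisedNullRayFrom 𝒟.timeOrientation 𝒟.embed 𝒟.normal p γ dom)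
    {t : ℝ} (ht : t ∈ dom) (h0 : 0 < t) {S : Set 𝒟.carrier} (hS : γ t ∈ closure S) :
    γ t ∈ closure (S ∩ 𝒟.metric.causalFuture 𝒟.timeOrientation (range 𝒟.embed)) := by
  have hI := mem_chronologicalFuture_range_of_pos hγ ht h0
  have hIo := LorentzianMetric.isOpen_chronologicalFuture_of_boundaryless 𝒟.metric 𝒟.timeOrientation
    (range 𝒟.embed)
  have h1 : γ t ∈ closure (𝒟.metric.chronologicalFuture 𝒟.timeOrientation (range 𝒟.embed) ∩ S) :=
    hIo.inter_closure (mem_inter hI hS)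
  refine closure_mono (fun q hq ↦ ?_) h1
  exact ⟨hq.2, LorentzianMetric.chronologicalFuture_subset_causalFuture _ _ _ hq.1⟩

/-! ## §4. Hiddenness is a TAIL property of complete rays (push-up)

Along a complete ray, membership in the closure of a PAST set (such as `endVisibleRegion 𝒟` or
`I⁻(U)`) is an initial-segment property of the parameter, by push-up (`r ≪ q ≤ q' ⟹ r ≪ q'`,
O'Neill Cor. 14.1, the tree's `mem_chronologicalFuture_of_mem_causalFuture`). Hence NoHidden and (C)
only ask that every complete ray RETURN to the relevant closure at arbitrarily late parameters:
a ray is either end-visible (resp. settled) up to closure at all `t ≥ 0`, or eventually hidden for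
good. -/

/-- **From positive parameters to all `t ≥ 0`**: if every ray point of positive parameter lies in
the closed-up set `closure S`, so does every ray point of parameter `≥ 0` (`γ t = lim_{s ↓ t} γ s`).
[cite: ONeillSemiRiemannian1983, Ch. 3, p. 67] -/
theorem mem_closure_of_forall_pos [𝒟.metric.HasLeviCivita] {p : X} {γ : ℝ → 𝒟.carrier}
    {dom : Set ℝ} (hγ : 𝒟.metric.IsNormalisedNullRayFrom 𝒟.timeOrientation 𝒟.embed 𝒟.normal p γ dom)
    (hdom : ¬ BddAbove dom) {S : Set 𝒟.carrier} (h : ∀ s ∈ dom, 0 < s → γ s ∈ closure S)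
    {t : ℝ} (ht : t ∈ dom) (h0 : 0 ≤ t) : γ t ∈ closure S := by
  have hc : Tendsto γ (𝓝[>] t) (𝓝 (γ t)) :=
    (continuousAt_of_isNormalisedNullRayFrom hγ ht).tendsto.mono_left nhdsWithin_le_nhds
  have hev : ∀ᶠ s in 𝓝[>] t, γ s ∈ closure S :=
    eventually_nhdsWithin_of_forall fun s hs ↦
      h s (Ici_subset_of_not_bddAbove hγ hdom (h0.trans (le_of_lt hs))) (h0.trans_lt hs)
  have h' := mem_closure_of_tendsto hc hev
  rwa [closure_closure] at h'

/-- **The closure of a past set is closed under the causal past**: if `I⁻(P) ⊆ P`, `q ≤ q'` and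
`q' ∈ closure P` then `q ∈ closure P` — points `r ≪ q` accumulate at `q`; `r ≪ q ≤ q'` gives `r ≪ q'`
(push-up), so the open `I⁺(r) ∋ q'` meets `P` at some `e`, and `r ≪ e ∈ P` puts `r ∈ I⁻(P) ⊆ P`.
[cite: ONeillSemiRiemannian1983, Ch. 14, Cor. 14.1 (p. 402)] -/
theorem mem_closure_of_mem_causalFuture_of_isPastSet [𝒟.metric.HasLeviCivita] {P : Set 𝒟.carrier}
    (hP : 𝒟.metric.IsPastSet 𝒟.timeOrientation P) {q q' : 𝒟.carrier}
    (hqq' : q' ∈ 𝒟.metric.causalFuture 𝒟.timeOrientation {q}) (hq' : q' ∈ closure P) :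
    q ∈ closure P := by
  have hn : (1 : ℕ∞ω) ≤ ((⊤ : ℕ∞) : ℕ∞ω) := WithTop.coe_le_coe.mpr le_top
  rw [mem_closure_iff_nhds]
  intro W hW
  have hcl : q ∈ closure (𝒟.metric.chronologicalPast 𝒟.timeOrientation {q}) :=
    𝒟.metric.subset_closure_chronologicalFuture 𝒟.timeOrientation.reverse {q} rfl
  obtain ⟨r, hrW, hrq⟩ := mem_closure_iff_nhds.1 hcl W hW
  have hrq' : r ∈ 𝒟.metric.chronologicalPast 𝒟.timeOrientation {q'} :=
    LorentzianMetric.mem_chronologicalFuture_of_mem_causalFuture (τ := 𝒟.timeOrientation.reverse) hn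
      (LorentzianMetric.mem_causalPast_of_mem_causalFuture hqq') hrq
  have hq'r : q' ∈ 𝒟.metric.chronologicalFuture 𝒟.timeOrientation {r} :=
    LorentzianMetric.mem_chronologicalFuture_of_mem_chronologicalPast hrq'
  obtain ⟨e, her, heP⟩ := mem_closure_iff_nhds.1 hq' _
    ((LorentzianMetric.isOpen_chronologicalFuture_of_boundaryless 𝒟.metric 𝒟.timeOrientation {r}).mem_nhds
      hq'r)
  exact ⟨r, hrW, hP (LorentzianMetric.chronologicalPast_mono (singleton_subset_iff.2 heP)
    (LorentzianMetric.mem_chronologicalPast_of_mem_chronologicalFuture her))⟩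

/-- Ray points are causally ordered by the parameter: `t ≤ t'` in the domain gives `γ t' ∈ J⁺(γ t)`.
[cite: ONeillSemiRiemannian1983, Ch. 14, p. 402] -/
theorem mem_causalFuture_of_le [𝒟.metric.HasLeviCivita] {p : X} {γ : ℝ → 𝒟.carrier} {dom : Set ℝ}
    (hγ : 𝒟.metric.IsNormalisedNullRayFrom 𝒟.timeOrientation 𝒟.embed 𝒟.normal p γ dom)
    {t t' : ℝ} (ht : t ∈ dom) (ht' : t' ∈ dom) (htt' : t ≤ t') :
    γ t' ∈ 𝒟.metric.causalFuture 𝒟.timeOrientation {γ t} := by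
  rcases htt'.eq_or_lt with rfl | hlt
  · exact Or.inl rfl
  · exact Or.inr ⟨γ t, rfl, γ, t, t', hlt,
      hγ.isFutureCausalCurveOn.mono (hγ.isMaximalGeodesicOn.2.1.out ht ht'), rfl, rfl⟩

/-- **Initial-segment property**: along a ray, membership in the closure of a past set `P` passes
from a parameter `t'` down to every `t ≤ t'`. [cite: ONeillSemiRiemannian1983, Ch. 14, Cor. 14.1 (p. 402)] -/
theorem mem_closure_of_le_of_isPastSet [𝒟.metric.HasLeviCivita] {P : Set 𝒟.carrier}
    (hP : 𝒟.metric.IsPastSet 𝒟.timeOrientation P) {p : X} {γ : ℝ → 𝒟.carrier} {dom : Set ℝ}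
    (hγ : 𝒟.metric.IsNormalisedNullRayFrom 𝒟.timeOrientation 𝒟.embed 𝒟.normal p γ dom)
    {t t' : ℝ} (ht : t ∈ dom) (ht' : t' ∈ dom) (htt' : t ≤ t') (h : γ t' ∈ closure P) :
    γ t ∈ closure P :=
  mem_closure_of_mem_causalFuture_of_isPastSet hP (mem_causalFuture_of_le hγ ht ht' htt') h

/-- **NoHidden is a tail condition** (registered sub-goal `stub_hiddenTail` of line `Sketch`):
`CompleteRaysNearEndVisible 𝒟` iff every future-complete normalised null ray from `Σ` returns to
`closure (endVisibleRegion 𝒟)` at arbitrarily late parameters — equivalently, NoHidden FAILS iff some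
complete ray from `Σ` is eventually hidden for good (`∃ γ T, ∀ t ≥ T, γ t ∉ closure (endVisibleRegion 𝒟)`).
(`endVisibleRegion 𝒟` is a past set, `isPastSet_endVisibleRegion`.) [cite: HawkingEllis1973, §6.8] -/
theorem completeRaysNearEndVisible_iff_frequently :
    CompleteRaysNearEndVisible 𝒟 ↔
      ∀ [𝒟.metric.HasLeviCivita], ∀ (p : X) (γ : ℝ → 𝒟.carrier) (dom : Set ℝ),
        𝒟.metric.IsNormalisedNullRayFrom 𝒟.timeOrientation 𝒟.embed 𝒟.normal p γ dom → ¬ BddAbove dom →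
          ∀ t ∈ dom, ∃ t' ∈ dom, t ≤ t' ∧ γ t' ∈ closure (endVisibleRegion 𝒟) := by
  constructor
  · intro h _ p γ dom hγ hdom t ht
    refine ⟨max t 0, Ici_subset_of_not_bddAbove hγ hdom (le_max_right t 0), le_max_left t 0, ?_⟩
    exact h p γ dom hγ hdom _ (Ici_subset_of_not_bddAbove hγ hdom (le_max_right t 0)) (le_max_right t 0)
  · intro h _ p γ dom hγ hdom t ht _
    obtain ⟨t', ht', htt', hcl⟩ := h p γ dom hγ hdom t ht
    exact mem_closure_of_le_of_isPastSet isPastSet_endVisibleRegion hγ ht ht' htt' hcl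

/-- **Registered sub-goal `stub_hiddenTail`** (one-line signature, = `completeRaysNearEndVisible_iff_frequently`).
[cite: HawkingEllis1973, §6.8] -/
theorem stub_hiddenTail : ∀ {X : Type} [TopologicalSpace X] [ChartedSpace E3 X] [IsManifold (𝓡 3) ∞ X] [ConnectedSpace X] {D : InitialDataSet (𝓡 3) X} {𝒟 : CauchyDevelopment D}, CompleteRaysNearEndVisible 𝒟 ↔ ∀ [𝒟.metric.HasLeviCivita], ∀ (p : X) (γ : ℝ → 𝒟.carrier) (dom : Set ℝ), 𝒟.metric.IsNormalisedNullRayFrom 𝒟.timeOrientation 𝒟.embed 𝒟.normal p γ dom → ¬ BddAbove dom → ∀ t ∈ dom, ∃ t' ∈ dom, t ≤ t' ∧ γ t' ∈ closure (endVisibleRegion 𝒟) :=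
  completeRaysNearEndVisible_iff_frequently

/-- **(C) for an honest region is a tail condition**: `RaysStayInClosure 𝒟 (exteriorOf 𝒟 U)` iff every
future-complete normalised null ray from `Σ` returns to `closure (exteriorOf 𝒟 U)` at arbitrarily late
parameters. (`⇐`: `closure (exteriorOf U) ⊆ closure I⁻(U)`, a past set, so all ray points of parameter
`≥ 0` lie in `closure I⁻(U)`; those of positive parameter lie in the open `I⁺(ι X)`, hence in
`closure (J⁺(ι X) ∩ I⁻(U))`, and `t = 0` follows by `mem_closure_of_forall_pos`.)
[cite: DafermosLuk2017, Conjecture 1] -/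
theorem raysStayInClosure_exteriorOf_iff_frequently (U : Set 𝒟.carrier) :
    _root_.Summit.FinalStateConjecture.RaysStayInClosure 𝒟 (_root_.Summit.FinalStateConjecture.exteriorOf 𝒟 U) ↔
      ∀ [𝒟.metric.HasLeviCivita], ∀ (p : X) (γ : ℝ → 𝒟.carrier) (dom : Set ℝ),
        𝒟.metric.IsNormalisedNullRayFrom 𝒟.timeOrientation 𝒟.embed 𝒟.normal p γ dom → ¬ BddAbove dom →
          ∀ t ∈ dom, ∃ t' ∈ dom, t ≤ t' ∧
            γ t' ∈ closure (_root_.Summit.FinalStateConjecture.exteriorOf 𝒟 U) := by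
  constructor
  · intro h _ p γ dom hγ hdom t ht
    refine ⟨max t 0, Ici_subset_of_not_bddAbove hγ hdom (le_max_right t 0), le_max_left t 0, ?_⟩
    exact h p γ dom hγ hdom _ (Ici_subset_of_not_bddAbove hγ hdom (le_max_right t 0)) (le_max_right t 0)
  · intro h _ p γ dom hγ hdom
    -- every ray point of parameter in the domain lies in `closure I⁻(U)`
    have hP : 𝒟.metric.IsPastSet 𝒟.timeOrientation
        (𝒟.metric.chronologicalPast 𝒟.timeOrientation U) :=
      LorentzianMetric.isPastSet_chronologicalPast U
    have hall : ∀ s ∈ dom, γ s ∈ closure (𝒟.metric.chronologicalPast 𝒟.timeOrientation U) := by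
      intro s hs
      obtain ⟨t', ht', hst', hcl⟩ := h p γ dom hγ hdom s hs
      exact mem_closure_of_le_of_isPastSet hP hγ hs ht' hst' (closure_mono inter_subset_right hcl)
    -- positive parameters: intersect with the open `I⁺(ι X)`
    refine fun t ht h0 ↦ mem_closure_of_forall_pos hγ hdom (fun s hs hs0 ↦ ?_) ht h0
    have h1 := mem_closure_inter_causalFuture_of_pos hγ hs hs0 (hall s hs)
    rwa [inter_comm] at h1

end Summit.FinalStateConjecture.FinalStateConjecture.Theorems.EndVisible
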